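import Summits.HodgeConjecture.HodgeConjecture.Theorems.FermatSurfaceSeparationLaw
import Literature.AlgebraicGeometry.Aoki1983.SemiStandard

/-!
# Exotic ∕ accidental Hodge pairs on squares of Fermat surfaces — kernel-certified ACCIDENTAL pairs (EXO-3),
# explicit exotic witnesses at the smallest non-separated degrees, and the identification with Aoki's `ξ₃₅`

Chapter «EXO» of cell hodge-nonav (planner p1 g31, memo `ROUTE-P1AD` §A–§C, Sketch `ROUTE-P1AD-Sketch.lean`
sha16 2efe8a64077626f5, `namespace HodgeNonAV.P1AD`, §A1–A3′), landed as tree theorems (ask A36-a) over the dictionary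
`Theorems/FermatSurfaceExoticPairsDefs` (`IsTransQuad`, `negM`, `IsHodgePair`, `IsExoticPair`, `IsAccidentalPair`,
`SharesCoordinate`, `FermatSep`) and AFTER the separation law of `Theorems/FermatSurfaceSeparation{Criterion,Sigma,
Closures,Law}` (`fermatSep_iff_fermatSepCriterion`, landed 2026-08-28 from planner p1's chapters P1AE∕P1AF): the parts of
the Sketch already in the tree are NOT restated here (the `negM` bookkeeping `count_negM` ∕ `negM_negM` ∕ `card_negM` ∕
`sum_negM` ∕ `isHodgeMultiset_negM` = `…Criterion`; EXO-1 `FermatSep p` for `p` prime = `fermatSep_of_prime` in `…Sigma`;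
`not_fermatSep_of_isExoticPair'`, `not_fermatSep_6'`, `not_fermatSep_8'` = `…Law`). What this file adds:

* `negM_add`, `IsHodgePair.symm` (Hodge pairs are symmetric: `Hom(V(w),V(u))` is Hodge iff `Hom(V(u),V(w))` is);
  `not_isExoticPair_prime` (EXO-1 in exotic form, from the tree's `fermatSep_of_prime`).
* EXO-3: explicit ACCIDENTAL pairs (accidental isomorphisms `V[u] ≅ V[w]` between DIFFERENT Galois-orbit pieces of
  `H²(X²ₘ, ℚ)`, kernel-certified by `decide`) at `m = 6, 33, 35, 44, 52, 70, 110`, with their shared-coordinate flags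
  (visibility on the Fermat fourfold `X⁴ₘ`). STATUS of their algebraicity (memo §D, NOT decided here): `m = 6` Shioda
  1979; `m = 33` derivable by LEVEL RAISING to `66`; `m = 35, 44, 52, 70` open IN PRINT but settled by existence arguments
  of cell pub-hfermat; `m = 110` GENUINELY OPEN (component of Aoki's semi-standard class `(2)ξ₅₅`).
* explicit exotic witnesses `not_fermatSep_9 ∕ 15 ∕ 21 ∕ 25 ∕ 35` (the `→` direction of the separation law at the smallest
  odd failing degrees, each by a named pair rather than through `not_fermatSep_of_not_criterion`).
* the `m = 35` accidental orbits identified BY NAME with Aoki's `ξ₃₅` (tree `Literature.AlgebraicGeometry.Aoki1983.xi35`):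
  `octuple_35_nonK3_eq_xi35`, `octuple_35_K3_eq_xi35`, `octuple_35_K3'_eq_octuple_35_K3`.

Prover seat hodge-nonav-19716-p2 g0 (`--supports stmt-HodgeConjecture-19652`, helper). No named fact, no definition, no
sorry; `decide +kernel` only on closed residue arithmetic mod `m ≤ 110`. These are statements about characters of Fermat
surfaces; nothing here proves the Hodge conjecture or decides the algebraicity of the exhibited classes.

References: Shioda, *The Hodge conjecture for Fermat varieties*, Math. Ann. 245 (1979) §1–§2 Thm. 1; N. Aoki, Math. Ann.
266 (1983) §5 Thm. D; N. Aoki, *Some new algebraic cycles on Fermat varieties*, J. Math. Soc. Japan 39 (1987) Thm. 2-1;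
G. da Silva Jr., arXiv:2101.04739 (2021) Thm. 2.2, Prop. 3.6.
-/

set_option linter.dupNamespace false

namespace Summit.HodgeConjecture.HodgeConjecture.Theorems.FermatSurfaceExoticPairs

open Multiset Literature.AlgebraicGeometry.HodgeTheory
open Literature.AlgebraicGeometry.HodgeTheory.FermatCharacter

variable {m : ℕ}

/-! ### Symmetry of Hodge pairs; EXO-1 in exotic form -/

/-- `−(s + t) = −s + −t`. [folklore] -/
theorem negM_add (s t : Multiset (ZMod m)) : negM (s + t) = negM s + negM t := by
  simp [negM, Multiset.map_add]

/-- Hodge pairs are symmetric (`Hom(V(w),V(u))` Hodge iff `Hom(V(u),V(w))` is). [cell hodge-nonav memo ROUTE-P1AD §A] -/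
theorem IsHodgePair.symm {u w : Multiset (ZMod m)} (h : IsHodgePair u w) : IsHodgePair w u := by
  refine ⟨h.2.1, h.1, ?_⟩
  have key : w + negM u = negM (u + negM w) := by rw [negM_add, negM_negM, add_comm]
  rw [key]
  exact isHodgeMultiset_negM h.2.2

/-- **EXO-1, exotic form: no exotic pairs in prime degree** — every Hodge pair on `X²_p × X²_p` is a coordinate
permutation (the tree's `fermatSep_of_prime`, through the Koblitz–Ogus ∕ Ran pairing `IsHodgeMultiset.count_neg_eq_count`),
so the Hodge classes in `T ⊗ T` are spanned by automorphism-graph components and `End_Hdg(T(X²_p)) = span Aut^*`. In print the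
CONCLUSION `HC⁴(X²_p × X²_p)` is Shioda 1979 ∕ Shioda–Katsura 1979. [cite: Ran1980, Prop. 1.8 (i)] [cite: Shioda1979PJA, §2 Thm. 1] -/
theorem not_isExoticPair_prime {p : ℕ} [Fact p.Prime] (u w : Multiset (ZMod p)) : ¬ IsExoticPair u w :=
  fun h ↦ h.2 (fermatSep_of_prime u w h.1)

/-! ### EXO-3: kernel-certified ACCIDENTAL pairs not reached by any inductive / standard supply
(census `fermat_exotic2.py`: label ACC = the octuple (or, if a coordinate is shared, the fourfold sextuple) is not in
the ℤ-span of pairs, `𝔅²ₘ`, semi-decomposable sextuples and Aoki's standard characters `σ_{p,a}`; for these `m` no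
printed theorem gives HC⁴(X²ₘ × X²ₘ): `m ∉ {prime} ∪ {≤ 21, 27} ∪ {pᵉ, 2pᵉ}`). Each theorem certifies: both quadruples
transcendental, the octuple Hodge, and `w ∉ (ℤ/m)ˣ • u` (accidental isomorphism between distinct CM pieces). -/

/-- m = 33, the K3-type piece `V[(1,4,13,15)]` (rank 20, h^{2,0} = 1) is Hodge-isomorphic to `V[(3,5,11,14)]`; no shared
coordinate (invisible on `X⁴₃₃`). [cell hodge-nonav memo ROUTE-P1AD §C, census m = 33] -/
theorem accidentalPair_33_K3 :
    IsAccidentalPair ({1, 4, 13, 15} : Multiset (ZMod 33)) {3, 5, 11, 14} := by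
  unfold IsAccidentalPair IsHodgePair IsTransQuad negM; decide +kernel

/-- m = 33, second partner of the same K3-type piece: `V[(1,4,13,15)] ≅ V[(5,8,9,11)]`. [cell hodge-nonav memo ROUTE-P1AD §C] -/
theorem accidentalPair_33_K3' :
    IsAccidentalPair ({1, 4, 13, 15} : Multiset (ZMod 33)) {5, 8, 9, 11} := by
  unfold IsAccidentalPair IsHodgePair IsTransQuad negM; decide +kernel

/-- m = 33, NON-K3 piece (h^{2,0} = 3, rank 20): `V[(1,4,6,22)] ≅ V[(2,5,8,18)]`, no shared coordinate — outside the
reach of BOTH the inductive structure and the K3 engine of route DerivedTorelliFermat. [cell hodge-nonav memo ROUTE-P1AD §C] -/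
theorem accidentalPair_33_nonK3 :
    IsAccidentalPair ({1, 4, 6, 22} : Multiset (ZMod 33)) {2, 5, 8, 18} := by
  unfold IsAccidentalPair IsHodgePair IsTransQuad negM; decide +kernel

/-- m = 33, da Silva's class seen on the square: `V[(3,7,10,13)] ≅ V[(3,5,11,14)]` SHARES the coordinate 3, and
`(7,10,13) # (−5,−11,−14) = (7,10,13,19,22,28)` is da Silva's non-quasi-decomposable fourfold class (Prop. 3.6) = crux
`Fermat33AccidentalClass` of route DerivedTorelliFermat. [cite: daSilva2021HodgeFermat, Prop. 3.6] -/
theorem accidentalPair_33_daSilva :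
    IsAccidentalPair ({3, 7, 10, 13} : Multiset (ZMod 33)) {3, 5, 11, 14} ∧
      SharesCoordinate ({3, 7, 10, 13} : Multiset (ZMod 33)) {3, 5, 11, 14} := by
  refine ⟨?_, ⟨3, by decide, by decide⟩⟩
  unfold IsAccidentalPair IsHodgePair IsTransQuad negM; decide +kernel

/-- m = 35 = 5·7 (HC⁴(X⁴₃₅) is printed — (35,6) = 1, m ≤ 100, da Silva Prop. 3.1 — but nothing printed reaches
X²₃₅ × X²₃₅ or X⁶₃₅): K3-type piece of rank 24 (> 21: beyond every hyperkähler carrier), `V[(1,8,11,15)] ≅ V[(2,7,9,17)]`, no shared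
coordinate; unreached by pairs, `𝔅²₃₅`, semi sextuples and Aoki `σ_{5,a}`, `σ_{7,a}`. [cell hodge-nonav memo ROUTE-P1AD §C] -/
theorem accidentalPair_35_K3 :
    IsAccidentalPair ({1, 8, 11, 15} : Multiset (ZMod 35)) {2, 7, 9, 17} := by
  unfold IsAccidentalPair IsHodgePair IsTransQuad negM; decide +kernel

/-- m = 35, second rank-24 K3-type accidental pair `V[(1,8,28,33)] ≅ V[(9,17,20,24)]`. [cell hodge-nonav memo ROUTE-P1AD §C] -/
theorem accidentalPair_35_K3' :
    IsAccidentalPair ({1, 8, 28, 33} : Multiset (ZMod 35)) {9, 17, 20, 24} := by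
  unfold IsAccidentalPair IsHodgePair IsTransQuad negM; decide +kernel

/-- m = 35, non-K3 (h^{2,0} = 2, rank 24) accidental pair `V[(1,3,8,23)] ≅ V[(4,5,7,19)]`. [cell hodge-nonav memo ROUTE-P1AD §C] -/
theorem accidentalPair_35_nonK3 :
    IsAccidentalPair ({1, 3, 8, 23} : Multiset (ZMod 35)) {4, 5, 7, 19} := by
  unfold IsAccidentalPair IsHodgePair IsTransQuad negM; decide +kernel

/-- m = 44: K3-type rank-20 accidental pair `V[(1,4,41,42)] ≅ V[(7,11,31,39)]` (one of 9 such orbits; 3 more with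
h^{2,0} = 2). [cell hodge-nonav memo ROUTE-P1AD §C] -/
theorem accidentalPair_44_K3 :
    IsAccidentalPair ({1, 4, 41, 42} : Multiset (ZMod 44)) {7, 11, 31, 39} := by
  unfold IsAccidentalPair IsHodgePair IsTransQuad negM; decide +kernel

/-- m = 52: rank-24, h^{2,0} = 2 accidental pair `V[(1,5,9,37)] ≅ V[(2,3,7,40)]` (one of 10 orbits, none K3-type).
[cell hodge-nonav memo ROUTE-P1AD §C] -/
theorem accidentalPair_52 :
    IsAccidentalPair ({1, 5, 9, 37} : Multiset (ZMod 52)) {2, 3, 7, 40} := by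
  unfold IsAccidentalPair IsHodgePair IsTransQuad negM; decide +kernel

/-- m = 70 = 2·5·7: the shared-coordinate accidental pair `V[(1,3,24,42)] ≅ V[(3,8,9,50)]` whose fourfold sextuple
`(1,24,42,62,61,20)` is the RESIDUAL orbit `{1,20,24,42,61,62}` of route DerivedTorelliFermat (m = 70), here with
h^{2,0} = 5. [cell hodge-nonav memo ROUTE-P1AD §C; Summit.HodgeConjecture...Theses.DerivedTorelliFermat, residual m = 70] -/
theorem accidentalPair_70_residual :
    IsAccidentalPair ({1, 3, 24, 42} : Multiset (ZMod 70)) {3, 8, 9, 50} ∧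
      SharesCoordinate ({1, 3, 24, 42} : Multiset (ZMod 70)) {3, 8, 9, 50} := by
  refine ⟨?_, ⟨3, by decide, by decide⟩⟩
  unfold IsAccidentalPair IsHodgePair IsTransQuad negM; decide +kernel

/-- m = 70: a rank-24 K3-type accidental pair WITHOUT shared coordinate, `V[(1,14,18,37)] ≅ V[(2,16,22,30)]` —
invisible on `X⁴₇₀`, so outside the DerivedTorelliFermat census altogether. [cell hodge-nonav memo ROUTE-P1AD §C] -/
theorem accidentalPair_70_K3_noshared :
    IsAccidentalPair ({1, 14, 18, 37} : Multiset (ZMod 70)) {2, 16, 22, 30} := by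
  unfold IsAccidentalPair IsHodgePair IsTransQuad negM; decide +kernel

/-! ### The smallest exotic pair (sanity of the dictionary)
The first composite degree already has an exotic pair: at `m = 6` the unique exotic orbit is `V[(1,1,1,3)] ≅ V[(1,1,2,2)]`
(duplication identity `{x} + {x+½} = {2x} + ½`): it shares a coordinate and its fourfold sextuple `(1,1,3,5,4,4)` is
decomposable — algebraic by Shioda (m ≤ 20).  So «exotic» is common; «accidental AND unreached» (EXO-3) is the rare,
open phenomenon. -/

/-- m = 6: the unique exotic orbit `V[(1,1,1,3)] ≅ V[(1,1,2,2)]` (accidental, shared coordinate; algebraic by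
Shioda 1979, m ≤ 20). [cite: Shioda1979PJA, §2 Thm. 1, list item 2)] -/
theorem accidentalPair_6 :
    IsAccidentalPair ({1, 1, 1, 3} : Multiset (ZMod 6)) {1, 1, 2, 2} ∧
      SharesCoordinate ({1, 1, 1, 3} : Multiset (ZMod 6)) {1, 1, 2, 2} := by
  refine ⟨?_, ⟨1, by decide, by decide⟩⟩
  unfold IsAccidentalPair IsHodgePair IsTransQuad negM; decide +kernel

/-! ### Explicit exotic witnesses at the smallest odd non-separated degrees
The separation law (`fermatSep_iff_fermatSepCriterion` in `Theorems/FermatSurfaceSeparationLaw`: separated ⟺ prime, `4`, or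
odd with all prime factors `≥ 7`) makes every `¬ FermatSep m` below a corollary of `not_fermatSep_of_not_criterion`; here the
`→` direction is witnessed at `m = 9, 15, 21, 25, 35` by NAMED exotic pairs (the even witnesses `m = 6, 8` are the tree's
`not_fermatSep_6'`, `not_fermatSep_8'`). [cell hodge-nonav memo ROUTE-P1AD §B–§C; census HOME/p1/route/fermat_exotic_census_m4-73.txt] -/

/-- m = 9 = 3² (triplication, `σ_{3,1} = (1,4,7,6)` plus two pairs): `(1,1,1,6) ~ (1,1,2,5)`. [cell hodge-nonav memo ROUTE-P1AD §C] -/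
theorem not_fermatSep_9 : ¬ FermatSep 9 :=
  not_fermatSep_of_isExoticPair' (u := {1, 1, 1, 6}) (w := {1, 1, 2, 5})
    (by unfold IsExoticPair IsHodgePair IsTransQuad negM; decide +kernel)

/-- m = 15 = 3·5: `(1,1,1,12) ~ (1,1,4,9)`. [cell hodge-nonav memo ROUTE-P1AD §C] -/
theorem not_fermatSep_15 : ¬ FermatSep 15 :=
  not_fermatSep_of_isExoticPair' (u := {1, 1, 1, 12}) (w := {1, 1, 4, 9})
    (by unfold IsExoticPair IsHodgePair IsTransQuad negM; decide +kernel)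

/-- m = 21 = 3·7: `(1,1,1,18) ~ (1,1,2,17)`. [cell hodge-nonav memo ROUTE-P1AD §C] -/
theorem not_fermatSep_21 : ¬ FermatSep 21 :=
  not_fermatSep_of_isExoticPair' (u := {1, 1, 1, 18}) (w := {1, 1, 2, 17})
    (by unfold IsExoticPair IsHodgePair IsTransQuad negM; decide +kernel)

/-- m = 25 = 5² (Aoki's `σ_{5,a}` plus a pair; the pair class is algebraic by Aoki 1987 Thm 2-1 — REACH):
`(1,2,6,16) ~ (2,4,5,14)`. [cite: Aoki1987, Thm. 2-1, Cor. 2-3] -/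
theorem not_fermatSep_25 : ¬ FermatSep 25 :=
  not_fermatSep_of_isExoticPair' (u := {1, 2, 6, 16}) (w := {2, 4, 5, 14})
    (by unfold IsExoticPair IsHodgePair IsTransQuad negM; decide +kernel)

/-- m = 35 = 5·7 (smallest class-C degree with an ACCIDENTAL unreached pair): not separated. [cell hodge-nonav memo ROUTE-P1AD §C] -/
theorem not_fermatSep_35 : ¬ FermatSep 35 :=
  not_fermatSep_of_isExoticPair' (u := {1, 8, 11, 15}) (w := {2, 7, 9, 17})
    (by unfold IsExoticPair IsHodgePair IsTransQuad negM; decide +kernel)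

/-! ### Identification with Aoki's semi-standard class `ξ₃₅`; the genuinely open degree `110`
The three accidental orbits at `m = 35` are the three `4 + 4` splittings of ONE octuple orbit: the unit multiples of
Aoki's semi-standard generator `ξ₃₅ = (1,2,16,17,21,22,30,31)` of `T₃₅` [Aoki, Math. Ann. 266 (1983) §5, Thm. D; tree
`Literature.AlgebraicGeometry.Aoki1983.xi35`, `isHodgeMultiset_xi35`] — the class of `X⁶₃₅` that cell pub-hfermat settles
for every `Xⁿ₃₅` by an existence argument (CANCEL-35 ← UNIRULED-70; no explicit cycle; not in print).  At `m = 110` the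
accidental orbits lie in the component of `(2)ξ₅₅` (tree `xi55Double`), the residual OPEN class of the fleet's census;
the shared-coordinate witness below has fourfold sextuple `(1,24,91) # (−29,−39,−48) = (1,24,62,71,81,91)`, the first
open unit orbit of the cell `(110, 4)` in pub-hfermat's OPEN-CELLS.md §A. -/

/-- m = 35: the non-K3 accidental octuple `(1,3,8,23) ∗ (−(4,5,7,19))` is `8 · ξ₃₅`. [cite: Aoki1983, §5 p. 37 (ξ_q), Thm. D
p. 38; tree `Aoki1983.xi35`] -/
theorem octuple_35_nonK3_eq_xi35 :
    ({1, 3, 8, 23} : Multiset (ZMod 35)) + negM {4, 5, 7, 19} =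
      (Literature.AlgebraicGeometry.Aoki1983.xi35).map (fun x => 8 * x) := by
  unfold negM Literature.AlgebraicGeometry.Aoki1983.xi35; decide +kernel

/-- m = 35: the K3-type accidental octuple `(1,8,11,15) ∗ (−(2,7,9,17))` is `18 · ξ₃₅`. [cite: Aoki1983, §5 p. 37, Thm. D p. 38;
tree `Aoki1983.xi35`] -/
theorem octuple_35_K3_eq_xi35 :
    ({1, 8, 11, 15} : Multiset (ZMod 35)) + negM {2, 7, 9, 17} =
      (Literature.AlgebraicGeometry.Aoki1983.xi35).map (fun x => 18 * x) := by
  unfold negM Literature.AlgebraicGeometry.Aoki1983.xi35; decide +kernel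

/-- m = 35: the third accidental orbit is a second splitting of the SAME octuple `18 · ξ₃₅`. [cell hodge-nonav memo ROUTE-P1AD §C] -/
theorem octuple_35_K3'_eq_octuple_35_K3 :
    ({1, 8, 28, 33} : Multiset (ZMod 35)) + negM {9, 17, 20, 24} =
      ({1, 8, 11, 15} : Multiset (ZMod 35)) + negM {2, 7, 9, 17} := by
  unfold negM; decide +kernel

/-- m = 110 = 2·5·11 (GENUINELY OPEN: component of Aoki's `(2)ξ₅₅`, the residual class of cell pub-hfermat's census):
`V[(1,24,91,104)] ≅ V[(29,39,48,104)]`, shared coordinate `104`, fourfold sextuple orbit `(1,24,62,71,81,91)` = the first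
open unit orbit of the cell `(110,4)`. Rank 40, h^{2,0} = 4. [cell hodge-nonav memo ROUTE-P1AD §C (kit j290871); pub-hfermat OPEN-CELLS.md §A] -/
theorem accidentalPair_110_shared :
    IsAccidentalPair ({1, 24, 91, 104} : Multiset (ZMod 110)) {29, 39, 48, 104} ∧
      SharesCoordinate ({1, 24, 91, 104} : Multiset (ZMod 110)) {29, 39, 48, 104} := by
  refine ⟨?_, ⟨104, by decide, by decide⟩⟩
  unfold IsAccidentalPair IsHodgePair IsTransQuad negM; decide +kernel

/-- m = 110: an accidental pair WITHOUT shared coordinate (invisible on `X⁴₁₁₀`; a class of `X⁶₁₁₀` in the cell `(110,6)`):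
`V[(1,3,23,83)] ≅ V[(4,7,17,82)]`, rank 40, h^{2,0} = 4 — genuinely open. [cell hodge-nonav memo ROUTE-P1AD §C (kit j290871)] -/
theorem accidentalPair_110_noshared :
    IsAccidentalPair ({1, 3, 23, 83} : Multiset (ZMod 110)) {4, 7, 17, 82} := by
  unfold IsAccidentalPair IsHodgePair IsTransQuad negM; decide +kernel

end Summit.HodgeConjecture.HodgeConjecture.Theorems.FermatSurfaceExoticPairs
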